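import Literature.Probability.LatticeModels.FKFreeArcPhase
import Literature.Probability.LatticeModels.FKFreeArcPassage
import Literature.Probability.LatticeModels.PhantomHarmonicComparison
import Literature.Probability.LatticeModels.FKIsingBarToRectangle
import HarnessLib

/-!
# The half-plane one-arm bound at a free boundary point of the critical FK-Ising model

Topic `Literature/Probability/LatticeModels`; part of the discharge programme for the named fact
`fkIsing_rsw` (Duminil-Copin–Hongler–Nolin 2011, Thm. 1 / Duminil-Copin–Smirnov 2012, Thm. 3.16).
This file proves the **point estimate** (`k = 0`) of DCHN's Lemma 15 — "the probability that a
boundary point of the free arc is connected to the wired arc at distance `n` is `O(n^{-1/2})`" — in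
the form `(hA)` consumed by `FKIsingRSWTwoPoint.fkIsing_rsw_of_halfPlaneArmBounds`, by assembling
the observable machinery of the tree in the three-sided box `LatticeDobrushin.threeSided W H`
(wired on three sides of `[0, W] × [0, H]`, free arc the row `[0, W] × {-1}`):

* geometry of the three-sided box: inner faces and interior edges at the sites of
  `[1, W-1] × [0, H-1]` (`isInnerFace_faceAt_threeSided`, `isInteriorEdge_threeSided`), the start
  corner `((0,0), 3)` (`startCorner_threeSided`), heights off the free arc, and the
  `FreeSideAdj`-chain of the faces of the bottom strip (`reflTransGen_freeSideAdj_threeSided`);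
* levels of a discrete primitive `(Hw, Hb)` of the observable (`IsFKPrimitive`): `Hw` is constant
  on the free arc (`= H_B`) and on the wired arc (`= H_A = H_B - 1`), whence `H_A ≤ Hw ≤ H_B`
  (`hw_mem_Icc_threeSided`, from `FKPrimitiveBounds`);
* **`levelB_sub_hw_le`** (DCHN Lemma 11, first item, for the primitive): for `x = (X, 0)` at
  distance `≥ d` from the wired arc, `H_B - Hw(x) ≤ 4/(d+4)` — `H_B - Hw` is a subsolution of the
  phantom Laplacian of `PhantomHarmonicComparison.lean` on the half `ℓ¹`-ball of radius `d - 1`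
  around `x` (`phantom_laplacian_hw` on the row above the free arc, Lemma 3.8 elsewhere), is
  `≤ 1` on the `ℓ¹`-sphere, and `dchn_lemma11_dist` applies;
* **`dartFlux_bottom_eq_openJoined_sq`**: `|F(e)|² = P(x ↔ wired arc)²` at the free-arc dart `e`
  below `x` (`FKFreeArcPassage.real_cSrc_mem_fkInterface_eq_openJoined` and
  `FKFreeArcPhase.dartFlux_qX_eq`), and `|F(e)|² = H_B - Hw(x)` (`hw_eq_of_neighbour_mem_zdArcB`),
  so **`openJoined_sq_le_threeSided`**: `P(x ↔ wired arc)² ≤ 4/(d+4)`;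
* the bridge to the lattice rectangle: the interface graph of the three-sided box of width `2N`
  and height `N` is the transposed image of the lattice rectangle `[0, N] × [0, 2N]` plus the
  isolated free-arc sites (`edgeFinset_interfaceGraph_threeSided`), the wired arc corresponds to
  the three wired sides (`mem_thrWired_iff`), so the three-wired rectangle measure of the arm
  event equals the Dobrushin probability of `(N, 0) ↔ wired arc`
  (`fkIsing_threeArm_eq_fkDobrushin`, via `rcMeasure_real_map_of_wired`,
  `rcMeasure_real_union_isolated`, `fkInterfaceMeasure_eq_map`);
* **`fkIsing_threeArm_le`**: `φ(centre of the free side ↔ three wired sides) ≤ 2/√N` in the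
  rectangle `[0, N] × [0, 2N]` (`rectThreeWired`, `rectCentre` are definitionally the
  `threeWired`, `threeBoxCentre` of `FKIsingRSWTwoPoint.lean`).

Everything is proved; no named fact is introduced.

## References

* H. Duminil-Copin, C. Hongler, P. Nolin, *Connection probabilities and RSW-type bounds for the
  two-dimensional FK Ising model*, Comm. Pure Appl. Math. 64 (2011) 1165–1198 (arXiv:0912.4253),
  §3.2 (Lemmas 11, 12) and §4 (Proposition 14, Lemma 15) — bib key `DuminilCopinHonglerNolin2011`.
* H. Duminil-Copin, S. Smirnov, *Conformal invariance of lattice models*, Clay Math. Proc. 15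
  (2012), §7.2 (Prop. 7.8) — bib key `DuminilCopinSmirnov2012Clay`.
* G. Grimmett, *The Random-Cluster Model* (2006), Lemma (4.13) — bib key `Grimmett2006`.
-/

noncomputable section

open MeasureTheory Finset SimpleGraph Set Complex Literature.Topology.PlaneTopology

namespace Literature.Probability.LatticeModels

namespace LatticeDobrushin

variable {W H : ℕ}

/-! ### Faces, edges and the start corner of the three-sided box -/

/-- All four faces at a site of `[1, W-1] × [0, H-1]` are inner faces of the three-sided box. [folklore] -/
theorem isInnerFace_faceAt_threeSided {u : Site 2} (hu : 1 ≤ u 0 ∧ u 0 + 1 ≤ (W : ℤ) ∧ 0 ≤ u 1 ∧ u 1 + 1 ≤ (H : ℤ))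
    (k : Fin 4) : (threeSided W H).toDobrushin.IsInnerFace (faceAt u k) := by
  rw [isInnerFace_threeSided_iff]
  have h0 := cornerOff_apply_zero_or_one k 0
  have h1 := cornerOff_apply_zero_or_one k 1
  simp only [faceAt, Pi.sub_apply]
  omega

/-- Every site of `[0, W] × [0, H]` (`W, H ≥ 1`) is a corner of an inner face of the three-sided box. [folklore] -/
theorem exists_isInnerFace_faceAt_threeSided (hW : 1 ≤ W) (hH : 1 ≤ H) {x : Site 2}
    (hx : 0 ≤ x 0 ∧ x 0 ≤ (W : ℤ) ∧ 0 ≤ x 1 ∧ x 1 ≤ (H : ℤ)) :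
    ∃ k, (threeSided W H).toDobrushin.IsInnerFace (faceAt x k) := by
  by_cases h0 : x 0 + 1 ≤ (W : ℤ)
  · by_cases h1 : x 1 + 1 ≤ (H : ℤ)
    · exact ⟨0, by rw [isInnerFace_threeSided_iff]; simp [faceAt, cornerOff]; omega⟩
    · exact ⟨3, by rw [isInnerFace_threeSided_iff]; simp [faceAt, cornerOff]; omega⟩
  · by_cases h1 : x 1 + 1 ≤ (H : ℤ)
    · exact ⟨1, by rw [isInnerFace_threeSided_iff]; simp [faceAt, cornerOff]; omega⟩
    · exact ⟨2, by rw [isInnerFace_threeSided_iff]; simp [faceAt, cornerOff, Pi.add_apply]; omega⟩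

/-- The coordinates of a lattice neighbour differ by at most one. [folklore] -/
theorem add_cornerUnit_apply_bounds (u : Site 2) (k : Fin 4) :
    (u + cornerUnit k) 0 ≤ u 0 + 1 ∧ u 0 ≤ (u + cornerUnit k) 0 + 1 ∧
      (u + cornerUnit k) 1 ≤ u 1 + 1 ∧ u 1 ≤ (u + cornerUnit k) 1 + 1 := by
  fin_cases k <;> simp [cornerUnit] <;> omega

/-- **Interior edges of the three-sided box**: an edge from a site of `[1, W-1] × [0, H-1]` to a site
off the bottom row `B` is interior in Smirnov's sense. [folklore] -/
theorem isInteriorEdge_threeSided {u : Site 2} (hu : 1 ≤ u 0 ∧ u 0 + 1 ≤ (W : ℤ) ∧ 0 ≤ u 1 ∧ u 1 + 1 ≤ (H : ℤ))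
    {k : Fin 4} (hv : 0 ≤ (u + cornerUnit k) 1) : (threeSided W H).toDobrushin.IsInteriorEdge u k := by
  have hb := add_cornerUnit_apply_bounds u k
  have huS : u ∈ (threeSided W H).S := by rw [mem_threeSided_S]; omega
  have hvS : u + cornerUnit k ∈ (threeSided W H).S := by rw [mem_threeSided_S]; omega
  have huB : u ∉ (threeSided W H).toDobrushin.zdArcB := by
    rw [zdArcB_threeSided]; rintro ⟨-, -, h⟩; omega
  have hvB : u + cornerUnit k ∉ (threeSided W H).toDobrushin.zdArcB := by
    rw [zdArcB_threeSided]; rintro ⟨-, -, h⟩; omega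
  have huA : u ∉ (threeSided W H).toDobrushin.zdArcA := by
    rw [zdArcA_threeSided, mem_threeSided_A]; rintro ⟨-, -, h⟩; omega
  refine ⟨?_, ?_, fun h => huA h.1, isInnerFace_faceAt_threeSided hu k, isInnerFace_faceAt_threeSided hu (k + 3)⟩
  · exact (threeSided W H).mem_edgeSet_iff.2 ⟨(SimpleGraph.mem_edgeSet _).1 (cSrc_mem_edgeSet (u, k)), huS, hvS⟩
  · intro x hx
    simp only [cSrc, Sym2.mem_iff] at hx
    rcases hx with rfl | rfl
    · exact huB
    · exact hvB

/-- **The start corner of the three-sided box** is the corner `((0, 0), 3)`: the `A`–`B` edge below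
the bottom-left wired corner, oriented downwards, has the inner face `(0, -1)` on its left.
[cite: Smirnov2001, §2] -/
theorem startCorner_threeSided (hW : 1 ≤ W) (hH : 1 ≤ H) :
    DiscreteDobrushin.startCorner (isZdAdmissible_threeSided hW hH) = ((![0, 0] : Site 2), (3 : Fin 4)) := by
  have hE := isZdAdmissible_threeSided hW hH
  have h1 := DiscreteDobrushin.isStartCorner_startCorner hE
  refine (DiscreteDobrushin.existsUnique_startCorner hE).unique ⟨h1.mem_zdArcA, h1.mem_zdArcB, h1.isOutEdge⟩ ⟨?_, ?_, ?_, ?_⟩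
  · rw [zdArcA_threeSided, mem_threeSided_A]; simp
  · show (![0, 0] : Site 2) + cornerUnit 3 ∈ _
    have e : (![0, 0] : Site 2) + cornerUnit 3 = ![0, -1] := by funext i; fin_cases i <;> simp [cornerUnit]
    rw [e, zdArcB_threeSided]; simp
  · rw [isInnerFace_threeSided_iff]; simp [faceAt, cornerOff]; omega
  · rw [isInnerFace_threeSided_iff]; simp [faceAt, cornerOff]

/-- The vertex of the start corner of the three-sided box is `(0, 0)`. [cite: Smirnov2001, §2] -/
theorem startCorner_threeSided_fst (hW : 1 ≤ W) (hH : 1 ≤ H) :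
    (DiscreteDobrushin.startCorner (isZdAdmissible_threeSided hW hH)).1 = ![0, 0] := by
  rw [startCorner_threeSided hW hH]

/-- The `B`-end of the start edge of the three-sided box is `(0, -1)`. [cite: Smirnov2001, §2] -/
theorem startCorner_threeSided_B (hW : 1 ≤ W) (hH : 1 ≤ H) :
    (DiscreteDobrushin.startCorner (isZdAdmissible_threeSided hW hH)).1 +
        cornerUnit (DiscreteDobrushin.startCorner (isZdAdmissible_threeSided hW hH)).2 = ![0, -1] := by
  rw [startCorner_threeSided hW hH]
  funext i; fin_cases i <;> simp [cornerUnit]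

/-- Off the bottom row, the sites of the three-sided box have nonnegative height. [folklore] -/
theorem height_nonneg_threeSided {v : Site 2} (hv : v ∈ meshDomain (threeSided W H).toDobrushin.Ω (threeSided W H).toDobrushin.δ)
    (hvB : v ∉ (threeSided W H).toDobrushin.zdArcB) : 0 ≤ v 1 := by
  rw [(threeSided W H).meshDomain_eq, mem_threeSided_S] at hv
  rw [zdArcB_threeSided] at hvB
  simp only [Set.mem_setOf_eq, not_and] at hvB
  have := hvB hv.1 hv.2.1
  omega

/-- **The faces of the bottom strip form a `FreeSideAdj`-chain** from the face `(0, -1)` of the start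
corner: consecutive faces `(i, -1)`, `(i + 1, -1)` share the side `{(i+1, -1), (i+1, 0)}` whose lower
end is on the free arc. [folklore] -/
theorem reflTransGen_freeSideAdj_threeSided (X : ℕ) (hX : (X : ℤ) + 1 ≤ W) :
    Relation.ReflTransGen (FreeSideAdj (threeSided W H).toDobrushin) ![0, -1] ![(X : ℤ), -1] := by
  induction X with
  | zero => simp only [Nat.cast_zero]; exact Relation.ReflTransGen.refl
  | succ X ih =>
    refine (ih (by push_cast at hX; omega)).tail ⟨?_, ?_⟩
    · rw [zdGraph_adj_iff]
      refine ⟨0, Or.inl ?_⟩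
      funext i; fin_cases i <;> simp
    · intro u w huf hug hwf hwg huw
      have hu0 := huf 0; have hu0' := hug 0; have hu1 := huf 1
      have hw0 := hwf 0; have hw0' := hwg 0; have hw1 := hwf 1
      simp at hu0 hu0' hu1 hw0 hw0' hw1
      push_cast at hX hu0' hw0'
      have hne : u 1 ≠ w 1 := by
        intro h
        apply huw
        funext i; fin_cases i
        · show u 0 = w 0; omega
        · exact h
      have hB := zdArcB_threeSided (W := W) (H := H)
      rcases (show u 1 = -1 ∨ w 1 = -1 by omega) with h | h
      · left; rw [hB]; exact ⟨by omega, by omega, h⟩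
      · right; rw [hB]; exact ⟨by omega, by omega, h⟩

/-! ### The primitive is constant on each arc of the three-sided box -/

section Levels

variable (hW : 1 ≤ W) (hH : 1 ≤ H) {Hw Hb : Site 2 → ℝ}
  (h : IsFKPrimitive (threeSided W H).toDobrushin (isZdAdmissible_threeSided hW hH) Hw Hb)
include h

/-- `Hw` is constant along the bottom row `B`: consecutive sites `(i, -1)`, `(i+1, -1)` corner the
inner face `(i, -1)` above them, on which `Hb` equals both values. [folklore] -/
theorem hw_bottom_eq (i : ℕ) (hi : (i : ℤ) ≤ W) : Hw ![(i : ℤ), -1] = Hw ![0, -1] := by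
  induction i with
  | zero => simp
  | succ i ih =>
    rw [← ih (by push_cast at hi; omega)]
    have hB := zdArcB_threeSided (W := W) (H := H)
    have hf : (threeSided W H).toDobrushin.IsInnerFace ![(i : ℤ), -1] := by
      rw [isInnerFace_threeSided_iff]; simp; push_cast at hi; omega
    have e1 : faceAt (![(i : ℤ), -1] : Site 2) 0 = ![(i : ℤ), -1] := by simp [faceAt, cornerOff]
    have e2 : faceAt (![((i + 1 : ℕ) : ℤ), -1] : Site 2) 1 = ![(i : ℤ), -1] := by
      funext j; fin_cases j <;> simp [faceAt, cornerOff]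
    have h1 := h.hb_eq_hw_of_mem_zdArcB (b := ![(i : ℤ), -1]) (by rw [hB]; simp; omega) (k := 0) (by rw [e1]; exact hf)
    have h2 := h.hb_eq_hw_of_mem_zdArcB (b := ![((i + 1 : ℕ) : ℤ), -1]) (by rw [hB]; simp; push_cast at hi ⊢; omega) (k := 1)
      (by rw [e2]; exact hf)
    rw [e1] at h1; rw [e2] at h2
    rw [← h1, ← h2]

/-- `Hw` is constant up the left column of the wired arc. [folklore] -/
theorem hw_left_eq (j : ℕ) (hj : (j : ℤ) ≤ H) : Hw ![0, (j : ℤ)] = Hw ![0, 0] := by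
  induction j with
  | zero => simp
  | succ j ih =>
    rw [← ih (by push_cast at hj; omega)]
    have hA := zdArcA_threeSided (W := W) (H := H)
    have e : (![0, (j : ℤ)] : Site 2) + cornerUnit 1 = ![0, ((j + 1 : ℕ) : ℤ)] := by
      funext i; fin_cases i <;> simp [cornerUnit]
    rw [← e]
    refine (h.hw_eq_hw_of_arcA ?_ ?_ (Or.inr ?_)).symm
    · rw [hA, mem_threeSided_A]; simp; omega
    · rw [e, hA, mem_threeSided_A]; simp; push_cast at hj ⊢; omega
    · rw [isInnerFace_threeSided_iff]; simp [faceAt, cornerOff]; push_cast at hj; omega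

/-- `Hw` is constant along the top row of the wired arc. [folklore] -/
theorem hw_top_eq (i : ℕ) (hi : (i : ℤ) ≤ W) : Hw ![(i : ℤ), (H : ℤ)] = Hw ![0, (H : ℤ)] := by
  induction i with
  | zero => simp
  | succ i ih =>
    rw [← ih (by push_cast at hi; omega)]
    have hA := zdArcA_threeSided (W := W) (H := H)
    have e : (![(i : ℤ), (H : ℤ)] : Site 2) + cornerUnit 0 = ![((i + 1 : ℕ) : ℤ), (H : ℤ)] := by
      funext j; fin_cases j <;> simp [cornerUnit]
    rw [← e]
    refine (h.hw_eq_hw_of_arcA ?_ ?_ (Or.inr ?_)).symm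
    · rw [hA, mem_threeSided_A]; simp; omega
    · rw [e, hA, mem_threeSided_A]; simp; push_cast at hi ⊢; omega
    · rw [isInnerFace_threeSided_iff]; simp [faceAt, cornerOff]; push_cast at hi; omega

/-- `Hw` is constant down the right column of the wired arc. [folklore] -/
theorem hw_right_eq (m : ℕ) (hm : (m : ℤ) ≤ H) : Hw ![(W : ℤ), (H : ℤ) - m] = Hw ![(W : ℤ), (H : ℤ)] := by
  induction m with
  | zero => simp
  | succ m ih =>
    rw [← ih (by push_cast at hm; omega)]
    have hA := zdArcA_threeSided (W := W) (H := H)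
    have e : (![(W : ℤ), (H : ℤ) - m] : Site 2) + cornerUnit 3 = ![(W : ℤ), (H : ℤ) - ((m + 1 : ℕ) : ℤ)] := by
      funext j; fin_cases j <;> simp [cornerUnit]; ring
    rw [← e]
    refine (h.hw_eq_hw_of_arcA ?_ ?_ (Or.inr ?_)).symm
    · rw [hA, mem_threeSided_A]; simp; omega
    · rw [e, hA, mem_threeSided_A]; simp; push_cast at hm ⊢; omega
    · rw [isInnerFace_threeSided_iff]; simp [faceAt, cornerOff]; push_cast at hm; omega

/-- **`Hw` is constant on the wired arc of the three-sided box.** [folklore] -/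
theorem hw_eq_of_mem_A {a : Site 2} (ha : a ∈ (threeSided W H).A) : Hw a = Hw ![0, 0] := by
  obtain ⟨⟨h0, h0', _, h1'⟩, h1, hwall⟩ := mem_threeSided_A.1 ha
  have htop : Hw ![0, (H : ℤ)] = Hw ![0, 0] := by
    have := hw_left_eq hW hH h H le_rfl; simpa using this
  rcases hwall with hx | hx | hx
  · -- left column
    have e : a = ![0, ((a 1).toNat : ℤ)] := by
      rw [Int.toNat_of_nonneg h1]; funext i; fin_cases i <;> simp [hx]
    rw [e, hw_left_eq hW hH h _ (by rw [Int.toNat_of_nonneg h1]; exact h1')]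
  · -- right column: `a = (W, H - m)`
    have e : a = ![(W : ℤ), (H : ℤ) - (((H : ℤ) - a 1).toNat : ℤ)] := by
      rw [Int.toNat_of_nonneg (by omega)]; funext i; fin_cases i <;> simp [hx]
    rw [e, hw_right_eq hW hH h _ (by rw [Int.toNat_of_nonneg (by omega)]; omega)]
    have := hw_top_eq hW hH h W le_rfl
    rw [this, htop]
  · -- top row
    have e : a = ![((a 0).toNat : ℤ), (H : ℤ)] := by
      rw [Int.toNat_of_nonneg h0]; funext i; fin_cases i <;> simp [hx]
    rw [e, hw_top_eq hW hH h _ (by rw [Int.toNat_of_nonneg h0]; exact h0'), htop]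

/-- **`Hw` is constant on the free arc of the three-sided box.** [folklore] -/
theorem hw_eq_of_mem_zdArcB_threeSided {b : Site 2} (hb : b ∈ (threeSided W H).toDobrushin.zdArcB) : Hw b = Hw ![0, -1] := by
  rw [zdArcB_threeSided] at hb
  obtain ⟨h0, h0', h1⟩ := hb
  have e : b = ![((b 0).toNat : ℤ), -1] := by
    rw [Int.toNat_of_nonneg h0]; funext i; fin_cases i <;> simp [h1]
  rw [e, hw_bottom_eq hW hH h _ (by rw [Int.toNat_of_nonneg h0]; exact h0')]

/-- The wired level `H_A = Hw (0, 0)` is the value of `Hw` on the whole wired arc. [folklore] -/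
theorem hcA_threeSided : ∀ a ∈ (threeSided W H).toDobrushin.zdArcA,
    (∃ k, (threeSided W H).toDobrushin.IsInnerFace (faceAt a k)) →
    Hw a = Hw (DiscreteDobrushin.startCorner (isZdAdmissible_threeSided hW hH)).1 := by
  intro a ha _
  rw [startCorner_threeSided_fst hW hH]
  rw [zdArcA_threeSided] at ha
  exact hw_eq_of_mem_A hW hH h ha

/-- The free level `H_B = Hw (0, -1)` is the value of `Hw` on the whole free arc. [folklore] -/
theorem hcB_threeSided : ∀ b ∈ (threeSided W H).toDobrushin.zdArcB,
    (∃ k, (threeSided W H).toDobrushin.IsInnerFace (faceAt b k)) →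
    Hw b = Hw ((DiscreteDobrushin.startCorner (isZdAdmissible_threeSided hW hH)).1 +
      cornerUnit (DiscreteDobrushin.startCorner (isZdAdmissible_threeSided hW hH)).2) := by
  intro b hb _
  rw [startCorner_threeSided_B hW hH]
  exact hw_eq_of_mem_zdArcB_threeSided hW hH h hb

/-- **The two levels**: `H_B = Hw (0, -1) = Hw (0, 0) + 1 = H_A + 1`. [cite: Smirnov2010, Lemma 4.11] -/
theorem levelB_threeSided : Hw ![0, -1] = Hw ![0, 0] + 1 := by
  have := h.jump_startCorner
  rwa [startCorner_threeSided_B hW hH, startCorner_threeSided_fst hW hH] at this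

/-- `H_A ≤ Hw ≤ H_B` at every site of `[0, W] × [0, H]`. [cite: Smirnov2010, proof of Lemma 5.2] -/
theorem hw_mem_Icc_threeSided {v : Site 2} (hv : 0 ≤ v 0 ∧ v 0 ≤ (W : ℤ) ∧ 0 ≤ v 1 ∧ v 1 ≤ (H : ℤ)) :
    Hw ![0, 0] ≤ Hw v ∧ Hw v ≤ Hw ![0, 0] + 1 := by
  have key := IsFKPrimitive.hw_mem_Icc h preconnected_zdArcA_threeSided (hcA_threeSided hW hH h) (hcB_threeSided hW hH h)
    (exists_isInnerFace_faceAt_threeSided hW hH hv)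
  rw [startCorner_threeSided_B hW hH, startCorner_threeSided_fst hW hH, levelB_threeSided hW hH h] at key
  exact key

end Levels

/-! ### From the three-sided box to the lattice rectangle with three wired sides -/

section Bridge

variable (N : ℕ)

/-- The Dobrushin data of the three-sided box of width `2N` and height `N` (abbreviation). [folklore] -/
abbrev thrD (N : ℕ) : DiscreteDobrushin := (threeSided (2 * N) N).toDobrushin

/-- The vertex type of its interface graph (abbreviation). [folklore] -/
abbrev ThrV (N : ℕ) : Type := ↥(meshDomain (thrD N).Ω (thrD N).δ)

/-- Transposition of the two coordinates of `ℤ²`. [folklore] -/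
def trSite (x : Site 2) : Site 2 := ![x 1, x 0]

/-- First coordinate of the transpose. [folklore] -/
@[simp] theorem trSite_apply_zero (x : Site 2) : trSite x 0 = x 1 := rfl

/-- Second coordinate of the transpose. [folklore] -/
@[simp] theorem trSite_apply_one (x : Site 2) : trSite x 1 = x 0 := rfl

/-- Transposition is an involution. [folklore] -/
@[simp] theorem trSite_trSite (x : Site 2) : trSite (trSite x) = x := by
  funext i; fin_cases i <;> rfl

/-- Transposition is injective. [folklore] -/
theorem trSite_injective : Function.Injective trSite := fun x y h => by
  rw [← trSite_trSite x, h, trSite_trSite]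

/-- Transposition preserves lattice adjacency. [folklore] -/
theorem zdGraph_adj_trSite {x y : Site 2} (h : (zdGraph 2).Adj x y) : (zdGraph 2).Adj (trSite x) (trSite y) := by
  rw [zdGraph_adj_iff] at h ⊢
  obtain ⟨i, hi | hi⟩ := h
  · refine ⟨1 - i, Or.inl ?_⟩
    rw [hi]; funext j; fin_cases i <;> fin_cases j <;> simp [trSite]
  · refine ⟨1 - i, Or.inr ?_⟩
    rw [hi]; funext j; fin_cases i <;> fin_cases j <;> simp [trSite]

/-- Transposition reflects lattice adjacency. [folklore] -/
theorem zdGraph_adj_trSite_iff {x y : Site 2} : (zdGraph 2).Adj (trSite x) (trSite y) ↔ (zdGraph 2).Adj x y :=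
  ⟨fun h => by simpa using zdGraph_adj_trSite h, zdGraph_adj_trSite⟩

/-- **The transposed inclusion of the rectangle `[0, N] × [0, 2N]` into the three-sided box of width
`2N` and height `N`**: `(a, b) ↦ (b, a)`, so that the free side `a = 0` goes to the row above the
free arc and the three wired sides go to the wired arc. [folklore] -/
def transposeEmb (N : ℕ) : RectV N (2 * N) ↪ ThrV N where
  toFun v := ⟨trSite v.1, by
    rw [(threeSided (2 * N) N).meshDomain_eq, mem_threeSided_S]
    have := isReg_of_mem_rectangle (Finset.mem_coe.1 v.2)
    unfold IsReg at this
    simp only [trSite_apply_zero, trSite_apply_one]; push_cast; omega⟩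
  inj' v w h := Subtype.ext (trSite_injective (congrArg (fun u : ThrV N => u.1) h))

/-- The underlying site of the transposed inclusion. [folklore] -/
@[simp] theorem transposeEmb_apply_val (v : RectV N (2 * N)) : (transposeEmb N v).1 = trSite v.1 := rfl

/-- A vertex of the three-sided box off the bottom row is in the range of the transposed inclusion. [folklore] -/
theorem exists_transposeEmb_of_height {u : ThrV N} (hu : 0 ≤ u.1 1) : ∃ v : RectV N (2 * N), transposeEmb N v = u := by
  have huS : u.1 ∈ (threeSided (2 * N) N).S := by rw [← (threeSided (2 * N) N).meshDomain_eq]; exact u.2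
  rw [mem_threeSided_S] at huS
  refine ⟨⟨trSite u.1, Finset.mem_coe.2 (Percolation.mem_rectangle_iff.2 ?_)⟩, Subtype.ext (trSite_trSite u.1)⟩
  simp only [trSite_apply_zero, trSite_apply_one]; push_cast at huS ⊢; omega

/-- **The edges of the interface graph of the three-sided box are exactly the images of the edges of
the lattice rectangle** (the sites of the free arc are isolated in the interface graph). [folklore] -/
theorem edgeFinset_interfaceGraph_threeSided
    {instF : Fintype (thrD N).interfaceGraph.edgeSet}
    {instR : Fintype ((zdGraph 2).induce ((Percolation.rectangle N (2 * N) : Finset (Site 2)) : Set (Site 2))).edgeSet} :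
    @SimpleGraph.edgeFinset _ (thrD N).interfaceGraph instF =
      (@SimpleGraph.edgeFinset _ ((zdGraph 2).induce ((Percolation.rectangle N (2 * N) : Finset (Site 2)) : Set (Site 2))) instR).map
        (transposeEmb N).sym2Map := by
  classical
  ext e'
  rw [SimpleGraph.mem_edgeFinset, Finset.mem_map]
  constructor
  · intro he'
    induction e' using Sym2.ind with | h a b => ?_
    have hadj : (thrD N).interfaceGraph.Adj a b := (SimpleGraph.mem_edgeSet _).1 he'
    rw [DiscreteDobrushin.interfaceGraph_adj_iff, (threeSided (2 * N) N).adj_iff] at hadj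
    obtain ⟨⟨hab, haS, hbS⟩, haB, hbB⟩ := hadj
    obtain ⟨va, hva⟩ := exists_transposeEmb_of_height N (height_nonneg_threeSided a.2 haB)
    obtain ⟨vb, hvb⟩ := exists_transposeEmb_of_height N (height_nonneg_threeSided b.2 hbB)
    refine ⟨s(va, vb), ?_, ?_⟩
    · rw [SimpleGraph.mem_edgeFinset, SimpleGraph.mem_edgeSet, SimpleGraph.comap_adj, Function.Embedding.coe_subtype]
      have h1 : trSite va.1 = a.1 := by rw [← hva]; rfl
      have h2 : trSite vb.1 = b.1 := by rw [← hvb]; rfl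
      rw [← zdGraph_adj_trSite_iff, h1, h2]; exact hab
    · simp only [Function.Embedding.sym2Map_apply, Sym2.map_mk, hva, hvb]
  · rintro ⟨e, he, rfl⟩
    induction e using Sym2.ind with | h va vb => ?_
    rw [SimpleGraph.mem_edgeFinset, SimpleGraph.mem_edgeSet, SimpleGraph.comap_adj, Function.Embedding.coe_subtype] at he
    simp only [Function.Embedding.sym2Map_apply, Sym2.map_mk]
    refine (SimpleGraph.mem_edgeSet _).2 ?_
    rw [DiscreteDobrushin.interfaceGraph_adj_iff, (threeSided (2 * N) N).adj_iff]
    have ha := isReg_of_mem_rectangle (Finset.mem_coe.1 va.2)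
    have hb := isReg_of_mem_rectangle (Finset.mem_coe.1 vb.2)
    unfold IsReg at ha hb
    have haS : (transposeEmb N va).1 ∈ (threeSided (2 * N) N).S := by
      rw [← (threeSided (2 * N) N).meshDomain_eq]; exact (transposeEmb N va).2
    have hbS : (transposeEmb N vb).1 ∈ (threeSided (2 * N) N).S := by
      rw [← (threeSided (2 * N) N).meshDomain_eq]; exact (transposeEmb N vb).2
    refine ⟨⟨?_, haS, hbS⟩, ?_, ?_⟩
    · simp only [transposeEmb_apply_val]; exact zdGraph_adj_trSite he
    · rw [zdArcB_threeSided]; rintro ⟨-, -, h3⟩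
      simp only [transposeEmb_apply_val, trSite_apply_one] at h3; omega
    · rw [zdArcB_threeSided]; rintro ⟨-, -, h3⟩
      simp only [transposeEmb_apply_val, trSite_apply_one] at h3; omega

/-- The three wired sides of the rectangle `[0, N] × [0, 2N]`: the far side `a = N` and the two
lateral sides `b = 0`, `b = 2N` (the set `threeWired N` of `FKIsingRSWTwoPoint.lean`). [folklore] -/
def rectThreeWired (N : ℕ) : Set (RectV N (2 * N)) := {v | v.1 0 = N ∨ v.1 1 = 0 ∨ v.1 1 = 2 * N}

/-- The wired set of the comparison on the three-sided box: the wired arc together with the (idle)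
sites of the free arc. [folklore] -/
def thrWired (N : ℕ) : Set (ThrV N) := {u | u.1 ∈ (thrD N).zdArcA ∨ u.1 1 = -1}

/-- **The wired sets correspond** under the transposed inclusion (idle vertices wired). [folklore] -/
theorem mem_thrWired_iff (u : ThrV N) : u ∈ thrWired N ↔ ∀ v : RectV N (2 * N), transposeEmb N v = u → v ∈ rectThreeWired N := by
  have huS : u.1 ∈ (threeSided (2 * N) N).S := by rw [← (threeSided (2 * N) N).meshDomain_eq]; exact u.2
  rw [mem_threeSided_S] at huS
  constructor
  · rintro (hu | hu) v rfl
    · rw [zdArcA_threeSided, mem_threeSided_A] at hu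
      simp only [transposeEmb_apply_val, trSite_apply_zero, trSite_apply_one] at hu
      simp only [rectThreeWired, Set.mem_setOf_eq]; omega
    · have := isReg_of_mem_rectangle (Finset.mem_coe.1 v.2)
      unfold IsReg at this
      simp only [transposeEmb_apply_val, trSite_apply_one] at hu; omega
  · intro hall
    by_cases h1 : u.1 1 = -1
    · exact Or.inr h1
    · obtain ⟨v, rfl⟩ := exists_transposeEmb_of_height N (u := u) (by omega)
      have hv := hall v rfl
      simp only [rectThreeWired, Set.mem_setOf_eq] at hv
      have := isReg_of_mem_rectangle (Finset.mem_coe.1 v.2)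
      unfold IsReg at this
      left
      rw [zdArcA_threeSided, mem_threeSided_A]
      simp only [transposeEmb_apply_val, trSite_apply_zero, trSite_apply_one] at h1 ⊢
      push_cast; omega

/-- The sites of the free arc, as vertices of the interface graph. [folklore] -/
def freeRow (N : ℕ) : Finset (ThrV N) := Finset.univ.filter fun u => u.1 1 = -1

/-- The wired set of the comparison is the wired arc plus the free-arc sites. [folklore] -/
theorem thrWired_eq : thrWired N = (Subtype.val ⁻¹' (thrD N).zdArcA) ∪ ↑(freeRow N) := by
  ext u
  simp only [thrWired, freeRow, Set.mem_setOf_eq, Set.mem_union, Set.mem_preimage, Finset.coe_filter, Finset.mem_univ,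
    true_and]

/-- The sites of the free arc are isolated in the interface graph. [cite: Smirnov2010, §2.1] -/
theorem freeRow_isolated : ∀ u ∈ freeRow N, ∀ w, ¬ (thrD N).interfaceGraph.Adj u w := by
  intro u hu w hadj
  rw [freeRow, Finset.mem_filter] at hu
  rw [DiscreteDobrushin.interfaceGraph_adj_iff] at hadj
  have huS : u.1 ∈ (threeSided (2 * N) N).S := by rw [← (threeSided (2 * N) N).meshDomain_eq]; exact u.2
  rw [mem_threeSided_S] at huS
  exact hadj.2.1 (by rw [zdArcB_threeSided]; exact ⟨huS.1, huS.2.1, hu.2⟩)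

/-- The connection event under the FK Dobrushin measure of the three-sided box is the corresponding
event under the random-cluster measure of its interface graph (wired on the wired arc).
[cite: Smirnov2010, §2.1–2.2] -/
theorem fkDobrushin_real_openJoined_eq_threeSided (hN : 1 ≤ N) (x : ThrV N) :
    (fkDobrushinMeasure (thrD N)).real {ω | (thrD N).OpenJoinedToArcA x ω} =
      (open scoped Classical in
        rcMeasure (thrD N).interfaceGraph criticalFKIsingParam 2 (Subtype.val ⁻¹' (thrD N).zdArcA)).real
        {η | (thrD N).OpenJoinedToArcA x (DiscreteDobrushin.liftSet (thrD N) η)} := by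
  classical
  have hE := isZdAdmissible_threeSided (W := 2 * N) (H := N) (by omega) hN
  rw [fkDobrushinMeasure_of_pos _ hE.isBounded hE.delta_pos]
  have hinst : (_root_.Literature.Probability.LatticeModels.meshDomain_finite hE.isBounded hE.delta_pos).fintype =
      (inferInstance : Fintype (ThrV N)) :=
    Subsingleton.elim _ _
  rw [hinst, DiscreteDobrushin.fkInterfaceMeasure_eq_map, measureReal_def, measureReal_def,
    (DiscreteDobrushin.measurableEmbedding_liftSet (D := thrD N)).map_apply]
  rfl

/-- The centre `(0, N)` of the free side of the rectangle `[0, N] × [0, 2N]`. [folklore] -/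
def rectCentre (N : ℕ) : RectV N (2 * N) :=
  ⟨![0, (N : ℤ)], Finset.mem_coe.2 (Percolation.mem_rectangle_iff.2 (by simp; omega))⟩

/-- The site `(N, 0)` above the middle of the free arc, as a vertex of the three-sided box. [folklore] -/
def thrCentre (N : ℕ) : ThrV N := transposeEmb N (rectCentre N)

/-- The underlying site of `thrCentre N` is `(N, 0)`. [folklore] -/
@[simp] theorem thrCentre_val : (thrCentre N).1 = ![(N : ℤ), 0] := by
  show trSite ![0, (N : ℤ)] = _
  funext i; fin_cases i <;> rfl

open scoped Classical in
/-- **The three-wired rectangle measure is the interface-graph measure of the three-sided box**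
(transposed inclusion, idle free-arc vertices wired and then un-wired, being isolated): the
probability that the centre of the free side is joined to the three wired sides equals the
probability, for the random-cluster measure of the interface graph wired on the wired arc, that
`(N, 0)` is joined to the wired arc. [cite: Grimmett2006, Lemma (4.13)] -/
theorem fkIsing_threeArm_eq_rcMeasure :
    (fkIsingFiniteMeasure (Percolation.rectangle N (2 * N)) (rectThreeWired N)).real
        (Percolation.openCrossing Set.univ {rectCentre N} (rectThreeWired N)) =
      (rcMeasure (thrD N).interfaceGraph criticalFKIsingParam 2 (Subtype.val ⁻¹' (thrD N).zdArcA)).real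
        {η | (thrD N).OpenJoinedToArcA (thrCentre N) (DiscreteDobrushin.liftSet (thrD N) η)} := by
  classical
  have hWne : (rectThreeWired N).Nonempty :=
    ⟨⟨![0, 0], Finset.mem_coe.2 (Percolation.mem_rectangle_iff.2 (by simp))⟩, Or.inr (Or.inl (by simp))⟩
  have hE := edgeFinset_interfaceGraph_threeSided N (instF := SimpleGraph.fintypeEdgeSet _)
    (instR := SimpleGraph.fintypeEdgeSet _)
  rw [← rcMeasure_real_union_isolated (thrD N).interfaceGraph criticalFKIsingParam_mem_Icc two_pos
    (Subtype.val ⁻¹' (thrD N).zdArcA) (freeRow N) (freeRow_isolated N), ← thrWired_eq]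
  symm
  refine rcMeasure_real_map_of_wired (transposeEmb N) hE criticalFKIsingParam_mem_Icc two_pos hWne
    (fun u => mem_thrWired_iff N u) ?_
  intro ω hω
  -- the open subgraph of the interface graph determined by the lifted image configuration is the
  -- transported open graph
  have hgraph : (SimpleGraph.fromEdgeSet {e' : Sym2 (ThrV N) | e' ∈ (thrD N).interfaceGraph.edgeSet ∧
      Sym2.map Subtype.val e' ∈ DiscreteDobrushin.liftSet (thrD N) (↑(ω.map (transposeEmb N).sym2Map) : Percolation.BondConfig (ThrV N))}) =
      Percolation.openGraph (↑(ω.map (transposeEmb N).sym2Map) : Percolation.BondConfig (ThrV N)) := by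
    rw [Percolation.openGraph]
    congr 1
    ext e'
    simp only [Set.mem_setOf_eq, DiscreteDobrushin.liftSet, Set.mem_image, Finset.mem_coe]
    constructor
    · rintro ⟨-, e'', he'', heq⟩
      have : e'' = e' := Sym2.map.injective Subtype.val_injective heq
      rw [← this]; exact he''
    · intro he'
      refine ⟨?_, e', he', rfl⟩
      have : e' ∈ (ω.map (transposeEmb N).sym2Map) := he'
      have hsub : ω.map (transposeEmb N).sym2Map ⊆ (thrD N).interfaceGraph.edgeFinset := by
        rw [hE]; exact Finset.map_subset_map.2 hω
      exact SimpleGraph.mem_edgeFinset.1 (hsub this)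
  rw [mem_openCrossing_univ_iff (V := RectV N (2 * N)) (A := {rectCentre N}) (B := rectThreeWired N)]
  simp only [Set.mem_setOf_eq, DiscreteDobrushin.OpenJoinedToArcA, hgraph]
  rw [exists_reachable_map_iff (transposeEmb N) ω {rectCentre N} (rectThreeWired N)]
  simp only [Set.image_singleton, Set.mem_singleton_iff, exists_eq_left]
  constructor
  · rintro ⟨b', ⟨b, hb, rfl⟩, hr⟩
    refine ⟨transposeEmb N b, ?_, hr⟩
    have := (mem_thrWired_iff N (transposeEmb N b)).2 (fun v hv => by rw [(transposeEmb N).injective hv]; exact hb)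
    rcases this with h | h
    · exact h
    · exfalso
      have hreg := isReg_of_mem_rectangle (Finset.mem_coe.1 b.2)
      unfold IsReg at hreg
      simp only [transposeEmb_apply_val, trSite_apply_one] at h; omega
  · rintro ⟨b, hbA, hr⟩
    have hb0 : 0 ≤ b.1 1 := by
      rw [zdArcA_threeSided, mem_threeSided_A] at hbA; exact hbA.2.1
    obtain ⟨v, rfl⟩ := exists_transposeEmb_of_height N hb0
    refine ⟨transposeEmb N v, ⟨v, ?_, rfl⟩, hr⟩
    exact (mem_thrWired_iff N _).1 (Or.inl hbA) v rfl

/-- **The half-plane one-arm event of the three-wired rectangle is dominated by the connection event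
of the three-sided box**: `φ^{3 wired}_{[0,N]×[0,2N]}((0, N) ↔ wired sides) = P_{threeSided}((N, 0) ↔ A)`.
[cite: DuminilCopinHonglerNolin2011, §4, proof of Lemma 15] -/
theorem fkIsing_threeArm_eq_fkDobrushin (hN : 1 ≤ N) :
    (fkIsingFiniteMeasure (Percolation.rectangle N (2 * N)) (rectThreeWired N)).real
        (Percolation.openCrossing Set.univ {rectCentre N} (rectThreeWired N)) =
      (fkDobrushinMeasure (thrD N)).real {ω | (thrD N).OpenJoinedToArcA (thrCentre N) ω} := by
  rw [fkDobrushin_real_openJoined_eq_threeSided N hN, fkIsing_threeArm_eq_rcMeasure N]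

end Bridge

/-! ### DCHN Lemma 11 in the three-sided box: `H_B - Hw(x) ≤ 4/(d+4)` -/

/-- The four possible coordinate changes of a lattice step. [folklore] -/
theorem add_cornerUnit_coords (v : Site 2) (k : Fin 4) :
    ((v + cornerUnit k) 0 = v 0 + 1 ∧ (v + cornerUnit k) 1 = v 1 ∧ k = 0) ∨
    ((v + cornerUnit k) 0 = v 0 ∧ (v + cornerUnit k) 1 = v 1 + 1 ∧ k = 1) ∨
    ((v + cornerUnit k) 0 = v 0 - 1 ∧ (v + cornerUnit k) 1 = v 1 ∧ k = 2) ∨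
    ((v + cornerUnit k) 0 = v 0 ∧ (v + cornerUnit k) 1 = v 1 - 1 ∧ k = 3) := by
  fin_cases k <;> simp [cornerUnit, sub_eq_add_neg]

/-- The non-phantom directions at a site next to the free arc are `0, 1, 2`. [folklore] -/
theorem filter_not_mem_three : (Finset.univ.filter fun k : Fin 4 => k ∉ ({3} : Finset (Fin 4))) = {0, 1, 2} := by decide

section Harmonic

variable (hW : 1 ≤ W) (hH : 1 ≤ H) {Hw Hb : Site 2 → ℝ}
  (h : IsFKPrimitive (threeSided W H).toDobrushin (isZdAdmissible_threeSided hW hH) Hw Hb)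
include h

/-- **DCHN Lemma 11, first item, for the primitive of the three-sided box.** If the site `x = (X, 0)`
above the free arc is at distance `≥ d` from the wired arc (`d ≤ X`, `X + d ≤ W`, `d ≤ H`), then
`H_B - Hw(x) ≤ 4/(d + 4)`: on the half `ℓ¹`-ball `S = {Y ≥ 0, |X' - X| + Y ≤ d - 1}` the function
`H_B - Hw` is a subsolution of the phantom Laplacian with the phantom direction pointing to the free
arc along the row `Y = 0` (`phantom_laplacian_hw`; Lemma 3.8 at the other sites), it is `≤ 1`
(`Hw ≥ H_A = H_B - 1`) on the `ℓ¹`-sphere, and the distance barrier of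
`PhantomHarmonicComparison.lean` dominates it (`dchn_lemma11_dist`).
[cite: DuminilCopinHonglerNolin2011, §3.2, Lemma 11, first item] -/
theorem levelB_sub_hw_le (X d : ℕ) (hd : 1 ≤ d) (hdX : d ≤ X) (hXd : X + d ≤ W) (hdH : d ≤ H) :
    Hw ![0, -1] - Hw ![(X : ℤ), 0] ≤ 4 / ((d : ℝ) + 4) := by
  classical
  have hE := isZdAdmissible_threeSided hW hH
  have hA1 := preconnected_zdArcA_threeSided (W := W) (H := H)
  have hdX' : (d : ℤ) ≤ X := by exact_mod_cast hdX
  have hXd' : (X : ℤ) + d ≤ W := by exact_mod_cast hXd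
  have hdH' : (d : ℤ) ≤ H := by exact_mod_cast hdH
  set z : Site 2 := ![(X : ℤ), 0] with hz
  have hz0 : z 0 = X := by simp [hz]
  have hz1 : z 1 = 0 := by simp [hz]
  set S : Set (Site 2) := {v | 0 ≤ v 1 ∧ |v 0 - X| + v 1 + 1 ≤ d} with hS
  set P : Site 2 → Finset (Fin 4) := fun v => if v 1 = 0 then {3} else ∅ with hP
  set β : ℝ := Hw ![0, -1] with hβ
  set u : Site 2 → ℝ := fun v => β - Hw v with hu
  -- finiteness
  have hSfin : S.Finite := by
    refine (boxSites_finite ![(X : ℤ) - d, 0] ![(X : ℤ) + d, (d : ℤ)]).subset fun v hv => ?_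
    simp only [hS, Set.mem_setOf_eq] at hv
    have habs := le_abs_self (v 0 - X); have habs' := neg_abs_le (v 0 - X)
    intro i; fin_cases i <;> simp <;> omega
  have hSsub : ∀ v ∈ S, 0 ≤ v 1 - z 1 ∧ |v 0 - z 0| + (v 1 - z 1) + 1 ≤ d := by
    intro v hv
    simp only [hS, Set.mem_setOf_eq] at hv
    rw [hz0, hz1, sub_zero]; exact hv
  -- the range of the sites of `S`
  have hrangeS : ∀ v ∈ S, 1 ≤ v 0 ∧ v 0 + 1 ≤ (W : ℤ) ∧ 0 ≤ v 1 ∧ v 1 + 1 ≤ (H : ℤ) := by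
    intro v hv
    simp only [hS, Set.mem_setOf_eq] at hv
    have habs := le_abs_self (v 0 - X); have habs' := neg_abs_le (v 0 - X)
    omega
  -- the primitive relations at the darts of a site with four inner faces
  have hpair : ∀ v : Site 2, (∀ k, (threeSided W H).toDobrushin.IsInnerFace (faceAt v k)) →
      ∀ k : Fin 4, Hb (faceAt v k) - Hw v = dartFlux (threeSided W H).toDobrushin hE (v, k) :=
    fun v hfaces k => h (v, k) (hfaces k)
  have hpair' : ∀ v : Site 2, (∀ k, (threeSided W H).toDobrushin.IsInnerFace (faceAt v k)) →
      ∀ k : Fin 4, Hb (faceAt v k) - Hw (v + cornerUnit k) = dartFlux (threeSided W H).toDobrushin hE (v + cornerUnit k, k + 1) := by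
    intro v hfaces k
    have := h (v + cornerUnit k, k + 1) (by
      change (threeSided W H).toDobrushin.IsInnerFace (faceAt (v + cornerUnit k) (k + 1))
      rw [faceAt_add_unit_succ]; exact hfaces k)
    simp only [cFace] at this
    rwa [faceAt_add_unit_succ] at this
  -- **subsolution property**
  have hsub : ∀ v ∈ S, 0 ≤ phantomLaplacian P 0 u v := by
    intro v hv
    have hrange := hrangeS v hv
    have hfaces : ∀ k, (threeSided W H).toDobrushin.IsInnerFace (faceAt v k) := isInnerFace_faceAt_threeSided hrange
    have hΔ : ∑ k : Fin 4, (u (v + cornerUnit k) - u v) = -latticeLaplacian Hw v := by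
      simp only [hu, latticeLaplacian, ← Finset.sum_neg_distrib]
      exact Finset.sum_congr rfl fun k _ => by ring
    by_cases h0 : v 1 = 0
    · -- next to the free arc: the phantom relation
      have hPv : P v = {3} := if_pos h0
      have hb3 : v + cornerUnit 3 ∈ (threeSided W H).toDobrushin.zdArcB := by
        rw [zdArcB_threeSided]; simp [cornerUnit]; omega
      have hβ3 : Hw (v + cornerUnit 3) = β := hw_eq_of_mem_zdArcB_threeSided hW hH h hb3
      have key := phantom_laplacian_hw hE hA1 v hfaces ({3} : Finset (Fin 4))
        (fun k hk => isInteriorEdge_threeSided hrange (by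
          rcases add_cornerUnit_coords v k with ⟨-, e, -⟩ | ⟨-, e, -⟩ | ⟨-, e, -⟩ | ⟨-, -, rfl⟩
          · omega
          · omega
          · omega
          · simp at hk))
        (fun k hk => by rw [Finset.mem_singleton] at hk; subst hk; exact hb3) (hpair v hfaces) (hpair' v hfaces)
      rw [filter_not_mem_three, Finset.sum_singleton, hβ3] at key
      show 0 ≤ (∑ k ∈ Finset.univ.filter (fun k => k ∉ P v), (u (v + cornerUnit k) - u v)) +
        phantomWeight * ((P v).card : ℝ) * (0 - u v)
      rw [hPv, filter_not_mem_three, Finset.card_singleton, Nat.cast_one, mul_one]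
      rw [Finset.sum_insert (by decide), Finset.sum_insert (by decide), Finset.sum_singleton] at key ⊢
      simp only [hu, phantomWeight]
      nlinarith [key]
    · -- an interior site: Lemma 3.8
      have hPv : P v = ∅ := if_neg h0
      have hint : v ∈ (threeSided W H).toDobrushin.interiorSites := fun k =>
        isInteriorEdge_threeSided hrange (by have := add_cornerUnit_apply_bounds v k; omega)
      have hsuper := h.superharmonicOn_interiorSites hA1 v hint
      show 0 ≤ (∑ k ∈ Finset.univ.filter (fun k => k ∉ P v), (u (v + cornerUnit k) - u v)) +
        phantomWeight * ((P v).card : ℝ) * (0 - u v)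
      rw [hPv, Finset.card_empty, Nat.cast_zero, mul_zero, zero_mul, add_zero]
      have hfilt : (Finset.univ.filter fun k : Fin 4 => k ∉ (∅ : Finset (Fin 4))) = Finset.univ := by simp
      rw [hfilt, hΔ]
      have : latticeLaplacian Hw v ≤ 0 := hsuper
      linarith
  -- **boundary condition**
  have hbdry : ∀ x ∈ phantomOuterBoundary P S, u x ≤ 0 ∨ (u x ≤ 1 ∧ |x 0 - z 0| + (x 1 - z 1) = d) := by
    rintro x ⟨hxS, v, hv, k, hk, rfl⟩
    right
    have hrange := hrangeS v hv
    simp only [hS, Set.mem_setOf_eq] at hv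
    simp only [hS, Set.mem_setOf_eq, not_and, not_le] at hxS
    have habs := le_abs_self (v 0 - X); have habs' := neg_abs_le (v 0 - X)
    rw [hz0, hz1, sub_zero]
    -- coordinates of `x = v + e_k` and the triangle inequality
    have hcoord : 0 ≤ (v + cornerUnit k) 1 ∧ |(v + cornerUnit k) 0 - X| + (v + cornerUnit k) 1 ≤ d ∧
        0 ≤ (v + cornerUnit k) 0 ∧ (v + cornerUnit k) 0 ≤ (W : ℤ) ∧ (v + cornerUnit k) 1 ≤ (H : ℤ) := by
      rcases add_cornerUnit_coords v k with ⟨e0, e1, -⟩ | ⟨e0, e1, -⟩ | ⟨e0, e1, -⟩ | ⟨e0, e1, rfl⟩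
      · rw [e0, e1]
        have t := abs_add_le (v 0 - X) 1
        rw [abs_one, show v 0 - X + 1 = v 0 + 1 - X by ring] at t
        have t' := le_abs_self (v 0 + 1 - X); have t'' := neg_abs_le (v 0 + 1 - X)
        omega
      · rw [e0, e1]; omega
      · rw [e0, e1]
        have t := abs_sub_le (v 0 - 1 - X) (v 0 - X) 0
        rw [sub_zero, sub_zero, show v 0 - 1 - X - (v 0 - X) = -1 by ring, abs_neg, abs_one] at t
        have t' := le_abs_self (v 0 - 1 - X); have t'' := neg_abs_le (v 0 - 1 - X)
        omega
      · rw [e0, e1]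
        have : v 1 ≠ 0 := fun h0 => by simp [hP, h0] at hk
        omega
    obtain ⟨hx1, hxle, hx0, hx0', hx1'⟩ := hcoord
    have hgt := hxS hx1
    refine ⟨?_, by omega⟩
    -- `u x ≤ 1` from `Hw x ≥ H_A = H_B - 1`
    have hIcc := hw_mem_Icc_threeSided hW hH h (v := v + cornerUnit k) ⟨hx0, hx0', hx1, hx1'⟩
    have hlev := levelB_threeSided hW hH h
    simp only [hu, hβ]
    linarith [hIcc.1]
  -- **comparison with the distance barrier**
  have hzS : z ∈ S := by
    simp only [hS, Set.mem_setOf_eq, hz]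
    simp; omega
  have key := dchn_lemma11_dist hd hSfin hSsub hsub hbdry hzS
  simpa [hu, hβ, hz] using key

end Harmonic

/-! ### The flux at a free-arc dart is the squared connection probability -/

section OneArm

/-- **`|F(e)|² = P(x ↔ wired arc)²` at the free-arc dart below `x = (X, 0)`** (`0 < X < W`): the
passage of the interface through `e` is the connection event (`FKFreeArcPassage.lean`), and the
winding there is deterministic so that `|F(e)| = P(e ∈ γ)` (`FKFreeArcPhase.lean`).
[cite: DuminilCopinHonglerNolin2011, §3.2, Lemma 12] -/
theorem dartFlux_bottom_eq_openJoined_sq (hW : 1 ≤ W) (hH : 1 ≤ H) (X : ℕ) (hX0 : 1 ≤ X) (hXW : (X : ℤ) + 1 ≤ W)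
    (hx : (![(X : ℤ), 0] : Site 2) ∈ meshDomain (threeSided W H).toDobrushin.Ω (threeSided W H).toDobrushin.δ) :
    dartFlux (threeSided W H).toDobrushin (isZdAdmissible_threeSided hW hH) (![(X : ℤ), 0], 3) =
      ((fkDobrushinMeasure (threeSided W H).toDobrushin).real
        {ω | (threeSided W H).toDobrushin.OpenJoinedToArcA ⟨![(X : ℤ), 0], hx⟩ ω}) ^ 2 := by
  have hE := isZdAdmissible_threeSided hW hH
  have hq : (((![(X : ℤ), 0] : Site 2), (3 : Fin 4)) : Site 2 × Fin 4) = FreeArcPhase.qX (X : ℤ) := rfl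
  have hinner : (threeSided W H).toDobrushin.IsInnerFace (cFace (FreeArcPhase.qX (X : ℤ))) := by
    show (threeSided W H).toDobrushin.IsInnerFace (faceAt ![(X : ℤ), 0] 3)
    rw [isInnerFace_threeSided_iff]; simp [faceAt, cornerOff]; omega
  have hB : (![(X : ℤ), -1] : Site 2) ∈ (threeSided W H).toDobrushin.zdArcB := by
    rw [zdArcB_threeSided]; simp; omega
  have hc₀ : DiscreteDobrushin.startCorner hE = FreeArcPhase.c₀ 0 := by
    rw [startCorner_threeSided hW hH]; rfl
  have h1 := FreeArcPhase.dartFlux_qX_eq hE (L := 0) (X := (X : ℤ)) hc₀ (by exact_mod_cast hX0)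
    (fun v hv hvB => height_nonneg_threeSided hv hvB) hB hinner
  rw [hq, h1]
  have hqB : (FreeArcPhase.qX (X : ℤ)).1 + cornerUnit (FreeArcPhase.qX (X : ℤ)).2 ∈ (threeSided W H).toDobrushin.zdArcB := by
    show (![(X : ℤ), 0] : Site 2) + cornerUnit 3 ∈ _
    have e : (![(X : ℤ), 0] : Site 2) + cornerUnit 3 = ![(X : ℤ), -1] := by funext i; fin_cases i <;> simp [cornerUnit]
    rw [e]; exact hB
  have hchain : Relation.ReflTransGen (FreeSideAdj (threeSided W H).toDobrushin)
      (cFace (DiscreteDobrushin.startCorner hE)) (cFace (FreeArcPhase.qX (X : ℤ))) := by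
    rw [startCorner_threeSided hW hH]
    have e1 : cFace ((((![0, 0] : Site 2), (3 : Fin 4))) : Site 2 × Fin 4) = ![0, -1] := by
      show faceAt ![0, 0] 3 = _
      funext i; fin_cases i <;> simp [faceAt, cornerOff]
    have e2 : cFace (FreeArcPhase.qX (X : ℤ)) = ![(X : ℤ), -1] := by
      show faceAt ![(X : ℤ), 0] 3 = _
      funext i; fin_cases i <;> simp [faceAt, cornerOff]
    rw [e1, e2]
    exact reflTransGen_freeSideAdj_threeSided X hXW
  rw [real_cSrc_mem_fkInterface_eq_openJoined hE preconnected_zdArcA_threeSided (FreeArcPhase.qX (X : ℤ)) hqB hx hinner hchain]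
  rfl

/-- **The half-plane one-arm bound in the three-sided box.** For the critical FK-Ising Dobrushin
measure of the box `[0, W] × [-1, H]` wired on the left column, the top row and the right column of
`[0, W] × [0, H]` and free on the bottom row, and a site `x = (X, 0)` above the free arc at distance
`≥ d` from the wired arc (`d ≤ X`, `X + d ≤ W`, `d ≤ H`), `P(x ↔ wired arc)² ≤ 4/(d + 4)`: the
primitive of the observable exists (`exists_isFKPrimitive`), `P(x ↔ wired arc)² = |F(e)|² =
H_B - Hw(x)` at the free-arc dart `e` below `x`, and `H_B - Hw(x) ≤ 4/(d+4)` by DCHN's Lemma 11.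
This is the upper half of Duminil-Copin–Hongler–Nolin's Proposition 8 / Lemma 12 combined with
Lemma 11, at a free-arc point. [cite: DuminilCopinHonglerNolin2011, §3.2, Lemmas 11–12 and Proposition 14] -/
theorem openJoined_sq_le_threeSided (hW : 1 ≤ W) (hH : 1 ≤ H) (X d : ℕ) (hd : 1 ≤ d) (hdX : d ≤ X) (hXd : X + d ≤ W) (hdH : d ≤ H)
    (hx : (![(X : ℤ), 0] : Site 2) ∈ meshDomain (threeSided W H).toDobrushin.Ω (threeSided W H).toDobrushin.δ) :
    ((fkDobrushinMeasure (threeSided W H).toDobrushin).real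
        {ω | (threeSided W H).toDobrushin.OpenJoinedToArcA ⟨![(X : ℤ), 0], hx⟩ ω}) ^ 2 ≤ 4 / ((d : ℝ) + 4) := by
  obtain ⟨Hw, Hb, h⟩ := exists_isFKPrimitive (isZdAdmissible_threeSided hW hH)
    (preconnected_zdArcA_threeSided (W := W) (H := H)) (by exact holeFree_threeSided)
  rw [← dartFlux_bottom_eq_openJoined_sq hW hH X (by omega) (by omega) hx]
  have hrange : 1 ≤ (![(X : ℤ), 0] : Site 2) 0 ∧ (![(X : ℤ), 0] : Site 2) 0 + 1 ≤ (W : ℤ) ∧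
      0 ≤ (![(X : ℤ), 0] : Site 2) 1 ∧ (![(X : ℤ), 0] : Site 2) 1 + 1 ≤ (H : ℤ) := by
    simp; omega
  have hall := isInnerFace_faceAt_threeSided hrange
  have e3 : (![(X : ℤ), 0] : Site 2) + cornerUnit 3 = ![(X : ℤ), -1] := by funext i; fin_cases i <;> simp [cornerUnit]
  have hb : (![(X : ℤ), 0] : Site 2) + cornerUnit 3 ∈ (threeSided W H).toDobrushin.zdArcB := by
    rw [e3, zdArcB_threeSided]; simp; omega
  have e := h.hw_eq_of_neighbour_mem_zdArcB hall hb
  have hβ : Hw ((![(X : ℤ), 0] : Site 2) + cornerUnit 3) = Hw ![0, -1] := hw_eq_of_mem_zdArcB_threeSided hW hH h hb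
  have key := levelB_sub_hw_le hW hH h X d hd hdX hXd hdH
  linarith

end OneArm

/-- **Half-plane one-arm bound at the centre of the free side of the three-wired rectangle**
(the point estimate `k = 0` of Duminil-Copin–Hongler–Nolin's Lemma 15, in the form consumed by
`FKIsingRSWTwoPoint.fkIsing_rsw_of_halfPlaneArmBounds`): for the critical FK-Ising measure of the
lattice rectangle `[0, N] × [0, 2N]` wired on the far side `a = N` and on the two lateral sides
`b = 0`, `b = 2N` (and free on the side `a = 0`), the probability that the centre `(0, N)` of the
free side is joined to the wired sides by open edges is at most `2/√N`.
[cite: DuminilCopinHonglerNolin2011, §4, Lemma 15] -/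
theorem fkIsing_threeArm_le (N : ℕ) (hN : 1 ≤ N) :
    (fkIsingFiniteMeasure (Percolation.rectangle N (2 * N)) (rectThreeWired N)).real
        (Percolation.openCrossing Set.univ {rectCentre N} (rectThreeWired N)) ≤ 2 / Real.sqrt N := by
  rw [fkIsing_threeArm_eq_fkDobrushin N hN]
  have hx : (![(N : ℤ), 0] : Site 2) ∈ meshDomain (thrD N).Ω (thrD N).δ := by
    rw [← thrCentre_val N]; exact (thrCentre N).2
  have hsq := openJoined_sq_le_threeSided (W := 2 * N) (H := N) (by omega) hN N N hN le_rfl (by omega) le_rfl hx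
  have e : thrCentre N = ⟨![(N : ℤ), 0], hx⟩ := Subtype.ext (thrCentre_val N)
  rw [e]
  set Pr := (fkDobrushinMeasure (thrD N)).real {ω | (thrD N).OpenJoinedToArcA ⟨![(N : ℤ), 0], hx⟩ ω} with hPr
  have hP0 : 0 ≤ Pr := measureReal_nonneg
  have hN0 : (0 : ℝ) < N := by exact_mod_cast hN
  have h1 : Pr ^ 2 ≤ 4 / N := hsq.trans (div_le_div_of_nonneg_left (by norm_num) hN0 (by linarith))
  have h2 : Pr * Real.sqrt N ≤ 2 := by
    have hsq' : (Pr * Real.sqrt N) ^ 2 ≤ (2 : ℝ) ^ 2 := by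
      rw [mul_pow, Real.sq_sqrt hN0.le]
      calc Pr ^ 2 * N ≤ 4 / N * N := by gcongr
        _ = 4 := div_mul_cancel₀ _ hN0.ne'
        _ = (2 : ℝ) ^ 2 := by norm_num
    exact (pow_le_pow_iff_left₀ (by positivity) (by norm_num) two_ne_zero).1 hsq'
  rw [le_div_iff₀ (Real.sqrt_pos.2 hN0)]
  exact h2

end LatticeDobrushin

end Literature.Probability.LatticeModels
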